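import Literature.NumberTheory.GaloisRepresentations.HomDualCovariantSequence
import Literature.NumberTheory.EllipticCurves.KummerSelmerStructure
import HarnessLib

/-!
# `j_* (δ₀ w) = 0` in `H¹(K, Hom_ℤ(N, A'))` as soon as `j ∘ w : N₁ → A'` EXTENDS equivariantly to `P`
# (the contravariant connecting map of `0 → N₁ → P → N → 0` dies under a change of coefficients `j : A → A'`
# that makes the homomorphism extendable)

Topic `NumberTheory/GaloisRepresentations`; namespace `Literature.NumberTheory.GaloisRepresentations.HomDual`.
Theorems only (no definition, no named fact, no instance, no notation, no `sorry`); any field `K : Type`.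
Sequel of door-c6 g16's `HomDualPresentation` (the dual sequence `0 → Hom(N, A) → Hom(P, A) → Hom(N₁, A) → 0` of a
presentation against a Baer module `A`, its native connecting map `dualδ₀`, `dualδ₀_eq_zero_iff`) and of cell
bsd-wall's `HomDualCovariantSequence` (chl-p2 g7: the covariant `postcomp j : Hom_ℤ(N, A) → Hom_ℤ(N, A')`).

THE MATHEMATICS (a cocycle computation; NSW (1.3.2)).  Let `0 → N₁ —i→ P —p→ N → 0` be a short exact sequence of
discrete `Γ_K`-modules, `A` a Baer (e.g. divisible) discrete module, `A'` ANY discrete module, `j : A → A'` equivariant,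
`w : N₁ → A` equivariant.  The class `δ₀ w ∈ H¹(K, Hom_ℤ(N, A))` is represented by `σ ↦ c(σ)` with
`c(σ) ∘ p = σ•q − q` for a (non-equivariant) extension `q : P → A` of `w`.  **If `j ∘ w` extends to an EQUIVARIANT
`e : P → A'`** (`e ∘ i = j ∘ w`), then `j ∘ q − e` kills `i(N₁)`, so `j ∘ q − e = d ∘ p` for a (non-equivariant)
`d : N → A'`, and `(j ∘ c(σ)) ∘ p = σ•(j∘q) − j∘q = σ•(d∘p) − d∘p = (σ•d − d) ∘ p`; as `p` is onto,
`j ∘ c(σ) = σ•d − d` is a coboundary: **`H¹(j_*)(δ₀ w) = 0`** (`map_postcomp_dualδ₀_eq_zero_of_extends`).  (When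
`A'` is itself Baer this is `dualδ₀_eq_zero_iff` for `A'` after the naturality `H¹(j_*) ∘ δ₀^A = δ₀^{A'} ∘ (j ∘ –)`;
the point of the lemma is that NO hypothesis on `A'` is needed — intended `A' = J̄`, which is not divisible.)
Also: `precomp p` is injective on `Hom_ℤ(N, A')` (`precomp_injective_of_surjective`) and a homomorphism `P → A'`
killing `i(N₁)` factors through `p` (`exists_precomp_eq_of_precomp_eq_zero`), for every `A'`.

USE (property (e) of the `Ш²`-readout road to `poitouTate_sha_tateDual`, native form): with `0 → N₂ → P₁ → N₁ → 0` a
permutation cover of the relation lattice, `A = K̄ˣ`, `A' = J̄`, `j` the principal idèles: a locally trivial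
`y′ = δ₀ w ∈ H¹(K, Hom_ℤ(N₁, K̄ˣ))` has `j ∘ w` extending to `P₁ → J̄` by this seat's
`IdeleReadout.exists_comp_eq_unitsToIdele_of_localExtensions`, hence `H¹(j_*) y′ = 0`, hence (covariant exactness,
`IsSES.exists_δ₀_eq_of_map_one_eq_zero` for chl-p2 g7's `isSES_hom`) `y′ = δ₀(h)` for an equivariant `h : N₁ → C̄`
(`IdeleTorusHasseCovariant`).  HONEST FRAMING: cocycle algebra only; no case of Poitou–Tate or BSD is proved here.

## References
* J. Neukirch, A. Schmidt, K. Wingberg, *Cohomology of Number Fields* (2008), (1.3.2). [NeukirchSchmidtWingberg2008]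
* J.-P. Serre, *Galois Cohomology* (1997), I §2.2. [SerreGaloisCohomology1997]
* J. S. Milne, *Arithmetic Duality Theorems* (2nd ed. 2006), I §0 (0.8), I Thm. 4.10 (proof, p. 58). [MilneADT2006]
-/

noncomputable section

namespace Literature.NumberTheory.GaloisRepresentations

namespace HomDual

open Literature.Algebra.Homology Literature.Algebra.Homology.DiscreteRep ContRepresentation Field
  DiscreteGaloisModule Literature.NumberTheory.EllipticCurves

variable {K : Type} [Field K]
variable {X Y Z W W' : Type}
  [AddCommGroup X] [TopologicalSpace X] [DiscreteTopology X] [Module.Finite ℤ X]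
  [AddCommGroup Y] [TopologicalSpace Y] [DiscreteTopology Y] [Module.Finite ℤ Y]
  [AddCommGroup Z] [TopologicalSpace Z] [DiscreteTopology Z] [Module.Finite ℤ Z]
  [AddCommGroup W] [TopologicalSpace W] [DiscreteTopology W]
  [AddCommGroup W'] [TopologicalSpace W'] [DiscreteTopology W']
variable (ρX : DiscreteGaloisModule K X) (ρY : DiscreteGaloisModule K Y) (ρZ : DiscreteGaloisModule K Z)
  (ρA : DiscreteGaloisModule K W) (ρA' : DiscreteGaloisModule K W')
variable (i : ρX.toContRepresentation →ⁱL ρY.toContRepresentation)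
  (p : ρY.toContRepresentation →ⁱL ρZ.toContRepresentation)

/-! ## §1 `precomp p` on `Hom_ℤ(N, A')` for ANY `A'`: injective, with image the homomorphisms killing `i(N₁)` -/

/-- **`precomp p : Hom_ℤ(N, A') → Hom_ℤ(P, A')` is injective when `p` is onto** (any `A'`).
[cite: MilneADT2006, I §0 (0.8)] -/
theorem precomp_injective_of_surjective (hp : Function.Surjective p)
    {F F' : DiscreteRep.HomCarrier Z W'} (h : precomp ρY ρZ ρA' p F = precomp ρY ρZ ρA' p F') : F = F' := by
  have h' : (show Y →ₗ[ℤ] W' from precomp ρY ρZ ρA' p F) = (show Y →ₗ[ℤ] W' from precomp ρY ρZ ρA' p F') := h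
  change (show Z →ₗ[ℤ] W' from F) = (show Z →ₗ[ℤ] W' from F')
  refine LinearMap.ext fun z => ?_
  obtain ⟨y, rfl⟩ := hp z
  exact LinearMap.congr_fun h' y

/-- **A homomorphism `G : P → A'` killing `i(N₁)` factors through `p`** (middle exactness of the dual sequence with
ARBITRARY coefficients `A'`; no Baer hypothesis). [cite: MilneADT2006, I §0 (0.8)] -/
theorem exists_precomp_eq_of_precomp_eq_zero (hS : IsSES (toTopRepHom ρX ρY i) (toTopRepHom ρY ρZ p))
    (G : DiscreteRep.HomCarrier Y W') (hG : precomp ρX ρY ρA' i G = 0) :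
    ∃ d : DiscreteRep.HomCarrier Z W', precomp ρY ρZ ρA' p d = G := by
  have hG' : (show X →ₗ[ℤ] W' from precomp ρX ρY ρA' i G) = (0 : X →ₗ[ℤ] W') := hG
  have hker : LinearMap.ker p.toContinuousLinearMap.toLinearMap ≤ LinearMap.ker (show Y →ₗ[ℤ] W' from G) := by
    intro y hy
    obtain ⟨x, rfl⟩ := hS.exact_mid y hy
    exact LinearMap.congr_fun hG' x
  refine ⟨(((LinearMap.ker p.toContinuousLinearMap.toLinearMap).liftQ (show Y →ₗ[ℤ] W' from G) hker) ∘ₗ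
    (p.toContinuousLinearMap.toLinearMap.quotKerEquivOfSurjective hS.surjective).symm.toLinearMap :
      Z →ₗ[ℤ] W'), ?_⟩
  change (show Y →ₗ[ℤ] W' from precomp ρY ρZ ρA' p _) = (show Y →ₗ[ℤ] W' from G)
  refine LinearMap.ext fun y => ?_
  change ((LinearMap.ker p.toContinuousLinearMap.toLinearMap).liftQ (show Y →ₗ[ℤ] W' from G) hker)
    ((p.toContinuousLinearMap.toLinearMap.quotKerEquivOfSurjective hS.surjective).symm
      (p.toContinuousLinearMap.toLinearMap y)) = (show Y →ₗ[ℤ] W' from G) y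
  rw [LinearMap.quotKerEquivOfSurjective_symm_apply, Submodule.liftQ_apply]

/-! ## §2 The pushforward of `δ₀ w` along `j` vanishes when `j ∘ w` extends equivariantly -/

/-- Equivariance of `precomp`, pointwise on the carriers (the action of `Hom_ℤ(·, A')` as a `TopRep`).
[cite: MilneADT2006, I §0 (0.8)] -/
theorem precomp_ρ (u : ρY.toContRepresentation →ⁱL ρZ.toContRepresentation) (σ : absoluteGaloisGroup K)
    (F : DiscreteRep.HomCarrier Z W') :
    precomp ρY ρZ ρA' u ((homGaloisModule ρZ ρA').toTopRep.ρ σ F) =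
      (homGaloisModule ρY ρA').toTopRep.ρ σ (precomp ρY ρZ ρA' u F) :=
  ContinuousRep.hom_comm_apply (toTopRepHom (homGaloisModule ρZ ρA') (homGaloisModule ρY ρA') (precomp ρY ρZ ρA' u)) σ F

/-- Equivariance of `postcomp`, pointwise on the carriers. [cite: MilneADT2006, I §0 (0.8)] -/
theorem postcomp_ρ (j : ρA.toContRepresentation →ⁱL ρA'.toContRepresentation) (σ : absoluteGaloisGroup K)
    (F : DiscreteRep.HomCarrier Y W) :
    postcomp ρY ρA ρA' j ((homGaloisModule ρY ρA).toTopRep.ρ σ F) =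
      (homGaloisModule ρY ρA').toTopRep.ρ σ (postcomp ρY ρA ρA' j F) :=
  ContinuousRep.hom_comm_apply (toTopRepHom (homGaloisModule ρY ρA) (homGaloisModule ρY ρA') (postcomp ρY ρA ρA' j)) σ F

/-- **THE LEMMA.**  For the dual sequence of `0 → N₁ —i→ P —p→ N → 0` against a Baer module `A`, an equivariant
`j : A → A'` into ANY discrete module, and an equivariant `w : N₁ → A` (an invariant of `Hom_ℤ(N₁, A)`): if `j ∘ w`
extends along `i` to an EQUIVARIANT `e : P → A'`, then `H¹(j_*)(δ₀ w) = 0` in `H¹(K, Hom_ℤ(N, A'))`.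
[cite: NeukirchSchmidtWingberg2008, (1.3.2)] [cite: SerreGaloisCohomology1997, I §2.2] -/
theorem map_postcomp_dualδ₀_eq_zero_of_extends (hS : IsSES (toTopRepHom ρX ρY i) (toTopRepHom ρY ρZ p))
    (hW : Module.Baer ℤ W) (j : ρA.toContRepresentation →ⁱL ρA'.toContRepresentation)
    (w : (homGaloisModule ρX ρA).toTopRep.ρ.invariants) (e : (homGaloisModule ρY ρA').toTopRep.ρ.invariants)
    (hext : precomp ρX ρY ρA' i (e.1 : DiscreteRep.HomCarrier Y W') =
      postcomp ρX ρA ρA' j (w.1 : DiscreteRep.HomCarrier X W)) :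
    galoisCohomology.map (postcomp ρZ ρA ρA' j) 1 (dualδ₀ ρX ρY ρZ ρA i p hS hW w) = 0 := by
  set D := isSES_dual ρX ρY ρZ ρA i p hS hW with hD
  -- an extension `q : P → A` of `w` (not equivariant), representing cocycle `c` with `c(σ) ∘ p = σ•q − q`
  obtain ⟨q, hq⟩ := D.surjective (w.1 : DiscreteRep.HomCarrier X W)
  have hqw : precomp ρX ρY ρA i q = (w.1 : DiscreteRep.HomCarrier X W) := hq
  rw [dualδ₀_apply, D.δ₀_apply_eq w q hq, galoisCohomology.map_one_oneCocycleClass]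
  -- `j ∘ q − e` kills `i(N₁)`, so it is `d ∘ p`
  have hkill : precomp ρX ρY ρA' i (postcomp ρY ρA ρA' j q - (e.1 : DiscreteRep.HomCarrier Y W')) = 0 := by
    rw [map_sub, ← postcomp_precomp, hqw, hext, sub_self]
  obtain ⟨d, hd⟩ := exists_precomp_eq_of_precomp_eq_zero ρX ρY ρZ ρA' i p hS _ hkill
  refine (oneCocycleClass_eq_zero_iff _ _).2 ⟨d, fun σ => ?_⟩
  -- compare after `precomp p` (injective as `p` is onto)
  apply precomp_injective_of_surjective ρY ρZ ρA' p hS.surjective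
  change precomp ρY ρZ ρA' p (postcomp ρZ ρA ρA' j ((D.δ₀Cocycle q (by rw [hq]; exact w.2)).1 σ)) =
    precomp ρY ρZ ρA' p ((homGaloisModule ρZ ρA').toTopRep.ρ σ d - d)
  rw [← postcomp_precomp, map_sub, precomp_ρ, hd]
  -- the left side is `j ∘ (σ•q − q)`
  have hc : precomp ρY ρZ ρA p ((D.δ₀Cocycle q (by rw [hq]; exact w.2)).1 σ) =
      (homGaloisModule ρY ρA).toTopRep.ρ σ q - q :=
    D.f_δ₀Cocycle_apply q (by rw [hq]; exact w.2) σ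
  rw [hc, map_sub, postcomp_ρ, map_sub]
  -- `σ•e = e`
  have he : (homGaloisModule ρY ρA').toTopRep.ρ σ (e.1 : DiscreteRep.HomCarrier Y W') = e.1 := e.2 σ
  rw [he]
  abel

/-- The same with the extension hypothesis stated pointwise: `e (i x) = j (w x)` for all `x`.
[cite: NeukirchSchmidtWingberg2008, (1.3.2)] -/
theorem map_postcomp_dualδ₀_eq_zero_of_extends' (hS : IsSES (toTopRepHom ρX ρY i) (toTopRepHom ρY ρZ p))
    (hW : Module.Baer ℤ W) (j : ρA.toContRepresentation →ⁱL ρA'.toContRepresentation)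
    (w : (homGaloisModule ρX ρA).toTopRep.ρ.invariants) (e : (homGaloisModule ρY ρA').toTopRep.ρ.invariants)
    (hext : ∀ x : X, (show Y →ₗ[ℤ] W' from (e.1 : DiscreteRep.HomCarrier Y W')) (i x) =
      j ((show X →ₗ[ℤ] W from (w.1 : DiscreteRep.HomCarrier X W)) x)) :
    galoisCohomology.map (postcomp ρZ ρA ρA' j) 1 (dualδ₀ ρX ρY ρZ ρA i p hS hW w) = 0 :=
  map_postcomp_dualδ₀_eq_zero_of_extends ρX ρY ρZ ρA ρA' i p hS hW j w e (LinearMap.ext fun x => hext x)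

end HomDual

end Literature.NumberTheory.GaloisRepresentations

end
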